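import Literature.MathematicalPhysics.QuantumManyBody.OneBodyCurrentGain
import Literature.MathematicalPhysics.QuantumManyBody.WeightedCorrector
import Mathlib.Algebra.QuadraticDiscriminant
import HarnessLib

/-!
# Cauchy–Schwarz for the shifted energy form of the periodic `N`-body problem

Topic `Literature/MathematicalPhysics/QuantumManyBody`; companion of `PeriodicBoseGas.lean`,
`OneBodyCurrentGain.lean` (`kineticDensityReal`) and `WeightedCorrector.lean`
(`integrableOn_cellN`). On the fundamental cell `[0,L)^{3N}` of the torus consider, for a
continuous real weight `W` (typically `W = V - E₀` with `V = ∑_{i<j} v^per(xᵢ - xⱼ)` and the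
ground-state energy `E₀`), the real quadratic form and its polar pairing

  `q_W(φ) = ∫ (|∇φ|² + W|φ|²)`,  `b_W(η, φ) = ∫ (Re ∑_{i,a} conj(∂_{i,a}η) ∂_{i,a}φ + W Re(conj(η) φ))`.

* `integral_form_weight_add_mul` — the exact second-order expansion
  `q_W(φ + tη) = q_W(φ) + 2t b_W(η, φ) + t² q_W(η)` (`t ∈ ℝ`);
* `sq_integral_re_conj_mul_le` — Cauchy–Schwarz for the mass pairing,
  `(∫ Re(conj(η)φ))² ≤ ∫|φ|² · ∫|η|²`;
* `sq_formPairing_le_of_nonneg` — **Cauchy–Schwarz for a non-negative form**: if `q_W ≥ 0` on a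
  class of `C¹` functions closed under `φ, η ↦ φ + tη` (here: `C¹`, `Lℤ³`-periodic, Bose-symmetric),
  then `b_W(η, φ)² ≤ q_W(φ) q_W(η)` on that class (discriminant of `t ↦ q_W(φ + tη) ≥ 0`).

With `W = V - E₀`, non-negativity of `q_W` on the symmetric periodic `C¹` class is the variational
principle (Rayleigh–Ritz) for the bosonic ground-state energy; the two inequalities are the
Cauchy–Schwarz steps of the sum-rule (moment) method [Stringari1995, §2; ReedSimonIV1978,
§XIII.1]. No definitions; `[folklore]`.
-/

noncomputable section

open MeasureTheory
open scoped ENNReal NNReal ComplexConjugate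

namespace Literature.MathematicalPhysics.QuantumManyBody.BoseGas

variable {N : ℕ} {L : ℝ}

/-! ### Pointwise expansions -/

/-- `|a + t b|² = |a|² + 2t Re(b̄ a) + t²|b|²` (`t` real). [folklore] -/
private theorem norm_sq_add_real_mul (a b : ℂ) (t : ℝ) :
    ‖a + (t : ℂ) * b‖ ^ 2 = ‖a‖ ^ 2 + 2 * t * (conj b * a).re + t ^ 2 * ‖b‖ ^ 2 := by
  simp only [Complex.sq_norm, Complex.normSq_apply, Complex.add_re, Complex.add_im, Complex.mul_re,
    Complex.mul_im, Complex.ofReal_re, Complex.ofReal_im, Complex.conj_re, Complex.conj_im]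
  ring

/-- Expansion of the kinetic density along `φ + tη`. [folklore] -/
theorem kineticDensityReal_add_real_mul {φ η : Config N → ℂ} {X : Config N}
    (hφ : DifferentiableAt ℝ φ X) (hη : DifferentiableAt ℝ η X) (t : ℝ) :
    kineticDensityReal (fun Y => φ Y + (t : ℂ) * η Y) X =
      kineticDensityReal φ X + 2 * t * (∑ i : Fin N, ∑ a : Fin 3,
        (conj (fderiv ℝ η X (Pi.single i (EuclideanSpace.single a (1 : ℝ)))) *
          fderiv ℝ φ X (Pi.single i (EuclideanSpace.single a (1 : ℝ)))).re) +
        t ^ 2 * kineticDensityReal η X := by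
  have hD : fderiv ℝ (fun Y => φ Y + (t : ℂ) * η Y) X = fderiv ℝ φ X + (t : ℂ) • fderiv ℝ η X := by
    rw [fderiv_fun_add hφ (hη.const_mul _), fderiv_const_mul hη]
  simp only [kineticDensityReal, hD, FunLike.coe_add, Pi.add_apply, FunLike.coe_smul,
    Pi.smul_apply, smul_eq_mul, norm_sq_add_real_mul, Finset.sum_add_distrib, Finset.mul_sum]

/-! ### Second-order expansion of the form -/

/-- **Exact second-order expansion of the weighted form** along `φ + tη`:
`q_W(φ + tη) = q_W(φ) + 2t b_W(η, φ) + t² q_W(η)` for `C¹` amplitudes and a continuous real weight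
`W` on the fundamental cell. [folklore] -/
theorem integral_form_weight_add_mul {W : Config N → ℝ} (hW : Continuous W) {φ η : Config N → ℂ}
    (hφ : ContDiff ℝ 1 φ) (hη : ContDiff ℝ 1 η) (t : ℝ) (L : ℝ) :
    ∫ X in cellN N L, (kineticDensityReal (fun Y => φ Y + (t : ℂ) * η Y) X +
        W X * ‖φ X + (t : ℂ) * η X‖ ^ 2) =
      (∫ X in cellN N L, (kineticDensityReal φ X + W X * ‖φ X‖ ^ 2)) +
        2 * t * (∫ X in cellN N L, ((∑ i : Fin N, ∑ a : Fin 3,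
            (conj (fderiv ℝ η X (Pi.single i (EuclideanSpace.single a (1 : ℝ)))) *
              fderiv ℝ φ X (Pi.single i (EuclideanSpace.single a (1 : ℝ)))).re) +
          W X * (conj (η X) * φ X).re)) +
        t ^ 2 * ∫ X in cellN N L, (kineticDensityReal η X + W X * ‖η X‖ ^ 2) := by
  have hφd := hφ.differentiable one_ne_zero
  have hηd := hη.differentiable one_ne_zero
  have hpt : ∀ X, kineticDensityReal (fun Y => φ Y + (t : ℂ) * η Y) X + W X * ‖φ X + (t : ℂ) * η X‖ ^ 2 =
      (kineticDensityReal φ X + W X * ‖φ X‖ ^ 2) +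
        2 * t * ((∑ i : Fin N, ∑ a : Fin 3,
            (conj (fderiv ℝ η X (Pi.single i (EuclideanSpace.single a (1 : ℝ)))) *
              fderiv ℝ φ X (Pi.single i (EuclideanSpace.single a (1 : ℝ)))).re) +
          W X * (conj (η X) * φ X).re) +
        t ^ 2 * (kineticDensityReal η X + W X * ‖η X‖ ^ 2) := by
    intro X
    rw [kineticDensityReal_add_real_mul (hφd X) (hηd X), norm_sq_add_real_mul]
    ring
  simp_rw [hpt]
  have hcK : Continuous fun X => ∑ i : Fin N, ∑ a : Fin 3,
      (conj (fderiv ℝ η X (Pi.single i (EuclideanSpace.single a (1 : ℝ)))) *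
        fderiv ℝ φ X (Pi.single i (EuclideanSpace.single a (1 : ℝ)))).re := by
    have h1 := hφ.continuous_fderiv one_ne_zero
    have h2 := hη.continuous_fderiv one_ne_zero
    fun_prop
  have i0 : IntegrableOn (fun X => kineticDensityReal φ X + W X * ‖φ X‖ ^ 2) (cellN N L) :=
    integrableOn_cellN ((continuous_kineticDensityReal hφ).add (hW.mul (hφ.continuous.norm.pow 2))) L
  have i1 : IntegrableOn (fun X => (∑ i : Fin N, ∑ a : Fin 3,
      (conj (fderiv ℝ η X (Pi.single i (EuclideanSpace.single a (1 : ℝ)))) *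
        fderiv ℝ φ X (Pi.single i (EuclideanSpace.single a (1 : ℝ)))).re) +
      W X * (conj (η X) * φ X).re) (cellN N L) :=
    integrableOn_cellN (hcK.add (hW.mul (Complex.continuous_re.comp
      ((Complex.continuous_conj.comp hη.continuous).mul hφ.continuous)))) L
  have i2 : IntegrableOn (fun X => kineticDensityReal η X + W X * ‖η X‖ ^ 2) (cellN N L) :=
    integrableOn_cellN ((continuous_kineticDensityReal hη).add (hW.mul (hη.continuous.norm.pow 2))) L
  have hA : Integrable (fun X => (kineticDensityReal φ X + W X * ‖φ X‖ ^ 2) +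
      2 * t * ((∑ i : Fin N, ∑ a : Fin 3,
        (conj (fderiv ℝ η X (Pi.single i (EuclideanSpace.single a (1 : ℝ)))) *
          fderiv ℝ φ X (Pi.single i (EuclideanSpace.single a (1 : ℝ)))).re) +
      W X * (conj (η X) * φ X).re)) (volume.restrict (cellN N L)) :=
    i0.add (i1.const_mul _)
  rw [integral_add hA (i2.const_mul _), integral_add i0 (i1.const_mul _), integral_const_mul,
    integral_const_mul]

/-- Expansion of the mass along `φ + tη`. [folklore] -/
private theorem integral_norm_sq_add_real_mul {φ η : Config N → ℂ} (hφ : Continuous φ)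
    (hη : Continuous η) (t L : ℝ) :
    ∫ X in cellN N L, ‖φ X + (t : ℂ) * η X‖ ^ 2 =
      (∫ X in cellN N L, ‖φ X‖ ^ 2) + 2 * t * (∫ X in cellN N L, (conj (η X) * φ X).re) +
        t ^ 2 * ∫ X in cellN N L, ‖η X‖ ^ 2 := by
  simp_rw [norm_sq_add_real_mul]
  have i0 : IntegrableOn (fun X => ‖φ X‖ ^ 2) (cellN N L) := integrableOn_cellN (hφ.norm.pow 2) L
  have i1 : IntegrableOn (fun X => (conj (η X) * φ X).re) (cellN N L) := integrableOn_cellN (by fun_prop) L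
  have i2 : IntegrableOn (fun X => ‖η X‖ ^ 2) (cellN N L) := integrableOn_cellN (hη.norm.pow 2) L
  have hA : Integrable (fun X => ‖φ X‖ ^ 2 + 2 * t * (conj (η X) * φ X).re)
      (volume.restrict (cellN N L)) := i0.add (i1.const_mul _)
  rw [integral_add hA (i2.const_mul _), integral_add i0 (i1.const_mul _), integral_const_mul,
    integral_const_mul]

/-! ### The two Cauchy–Schwarz inequalities -/

/-- From `0 ≤ c + 2tb + t²a` for all real `t`: `b² ≤ c a`. [folklore] -/
theorem sq_le_mul_of_forall_quadratic_nonneg {a b c : ℝ} (h : ∀ t : ℝ, 0 ≤ c + 2 * t * b + t ^ 2 * a) :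
    b ^ 2 ≤ c * a := by
  have hd := discrim_le_zero (a := a) (b := 2 * b) (c := c) fun t => by
    have := h t
    nlinarith
  rw [discrim] at hd
  nlinarith

/-- **Cauchy–Schwarz for the mass pairing** on the fundamental cell:
`(∫ Re(conj(η) φ))² ≤ ∫|φ|² · ∫|η|²` for continuous amplitudes. [folklore] -/
theorem sq_integral_re_conj_mul_le {φ η : Config N → ℂ} (hφ : Continuous φ) (hη : Continuous η)
    (L : ℝ) :
    (∫ X in cellN N L, (conj (η X) * φ X).re) ^ 2 ≤
      (∫ X in cellN N L, ‖φ X‖ ^ 2) * ∫ X in cellN N L, ‖η X‖ ^ 2 := by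
  refine sq_le_mul_of_forall_quadratic_nonneg fun t => ?_
  rw [← integral_norm_sq_add_real_mul hφ hη t L]
  exact integral_nonneg fun X => sq_nonneg _

/-- **Cauchy–Schwarz for a non-negative energy form.** Let `W` be a continuous real weight and
suppose the form `q_W(ψ) = ∫ (|∇ψ|² + W|ψ|²)` is non-negative on the `C¹`, `Lℤ³`-periodic,
Bose-symmetric amplitudes (for `W = V - E₀` this is the variational principle). Then for `φ, η` in
that class, `b_W(η, φ)² ≤ q_W(φ) q_W(η)` with the polar pairing
`b_W(η, φ) = ∫ (Re ∑ conj(∂η)∂φ + W Re(conj(η)φ))`. [cite: Stringari1995, §2 (after (8))] -/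
theorem sq_formPairing_le_of_nonneg {W : Config N → ℝ} (hW : Continuous W)
    (hnonneg : ∀ ψ : Config N → ℂ, ContDiff ℝ 1 ψ →
      (∀ (X : Config N) (i : Fin N) (c : Fin 3), ψ (X + Pi.single i (EuclideanSpace.single c L)) = ψ X) →
      (∀ (σ : Equiv.Perm (Fin N)) (X : Config N), ψ (X ∘ σ) = ψ X) →
      0 ≤ ∫ X in cellN N L, (kineticDensityReal ψ X + W X * ‖ψ X‖ ^ 2))
    {φ η : Config N → ℂ} (hφ : ContDiff ℝ 1 φ) (hη : ContDiff ℝ 1 η)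
    (hφper : ∀ (X : Config N) (i : Fin N) (c : Fin 3),
      φ (X + Pi.single i (EuclideanSpace.single c L)) = φ X)
    (hηper : ∀ (X : Config N) (i : Fin N) (c : Fin 3),
      η (X + Pi.single i (EuclideanSpace.single c L)) = η X)
    (hφsymm : ∀ (σ : Equiv.Perm (Fin N)) (X : Config N), φ (X ∘ σ) = φ X)
    (hηsymm : ∀ (σ : Equiv.Perm (Fin N)) (X : Config N), η (X ∘ σ) = η X) :
    (∫ X in cellN N L, ((∑ i : Fin N, ∑ a : Fin 3,
        (conj (fderiv ℝ η X (Pi.single i (EuclideanSpace.single a (1 : ℝ)))) *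
          fderiv ℝ φ X (Pi.single i (EuclideanSpace.single a (1 : ℝ)))).re) +
        W X * (conj (η X) * φ X).re)) ^ 2 ≤
      (∫ X in cellN N L, (kineticDensityReal φ X + W X * ‖φ X‖ ^ 2)) *
        ∫ X in cellN N L, (kineticDensityReal η X + W X * ‖η X‖ ^ 2) := by
  refine sq_le_mul_of_forall_quadratic_nonneg fun t => ?_
  rw [← integral_form_weight_add_mul hW hφ hη t L]
  refine hnonneg _ (hφ.add (contDiff_const.mul hη)) (fun X i c => ?_) (fun σ X => ?_)
  · simp only [hφper X i c, hηper X i c]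
  · simp only [hφsymm σ X, hηsymm σ X]

end Literature.MathematicalPhysics.QuantumManyBody.BoseGas

end
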